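import Literature.AlgebraicGeometry.HodgeTheory.LocallyTrivialExtensionClasses

/-!
# Route LinearSystemTorelli — crux `LocalTubeSpan`: the local kernel under the surrogate

Helper file (`--supports stmt-HodgeConjecture-2490`, line `Sketch`, stub `stub_localKernelForm`).
The crux ("local Schnell theorem", C. Schnell, *Primitive cohomology and the tube mapping*,
Math. Z. 268 (2010) = arXiv:0711.3927, §3, §7) is formalised at a subgroup `S ≤ G` — a local
fundamental group of the discriminant complement inside `G = π₁(S, s)` — by the **surrogate**
`ker (evalCoinvOn A S) = H1resKer A S`: a class undetected by every single element of `S`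
(`φ g ∈ (g - 1)A` for all `g ∈ S`) restricts to zero on `S` (the inclusion `≥` is the tree's
`H1resKer_le_ker_evalCoinvOn`).  This file records the typed SHAPE the planner of the crux types
against: granted the surrogate at all local subgroups `localSubgroup ι s N hs' γ` of a piece
`N ⊆ T`, the tree's `localKernelOn ι V s N` (P. Brosnan, H. Fang, Z. Nie, G. Pearlstein,
*Singularities of admissible normal functions*, Invent. Math. 177 (2009), §1 eq. (1): the classes
restricting to zero near a point) is literally the space of classes undetected on them, and the
local kernel `localKernel ι V s t₀` at a point `t₀` is the space of classes killed by Schnell's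
third map on the local subgroups of some neighbourhood of `t₀`:

* `localTubeSpan_localKernelOn_eq_iInf_ker_of_surrogate` — the registered stub:
  `localKernelOn ι V s N = ⨅_{s', hs', γ} ker (evalCoinvOn (monodromyRepObj V s) (localSubgroup …))`;
* `localTubeSpan_mem_localKernel_iff_of_surrogate` — the pointwise corollary:
  `ξ ∈ localKernel ι V s t₀ ↔ ∃ N ∈ 𝓝 t₀, ∀ s' hs' γ, evalCoinvOn … (localSubgroup ι s N hs' γ) ξ = 0`.

Pure bookkeeping over the tree's `LocallyTrivialExtensionClasses` (an arbitrary commutative ring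
`k`, continuous `ι : S → T`, local system `V` and base point `s`); no named facts.

References: [Schnell2010] C. Schnell, Primitive cohomology and the tube mapping, Math. Z. 268
(2010), §3 (the third map); [BrosnanFangNiePearlstein2009] P. Brosnan, H. Fang, Z. Nie,
G. Pearlstein, Singularities of admissible normal functions, Invent. Math. 177 (2009), §1 eq. (1).
-/

-- `Summit.HodgeConjecture.HodgeConjecture.Theorems` is the mandated namespace (single-conjunct summit:
-- Sub = Summit), which `linter.dupNamespace` flags on every declaration; the lakefile turns the
-- linter off tree-wide (weak option), restated here so stand-alone elaboration is warning-free too.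
set_option linter.dupNamespace false

noncomputable section

open CategoryTheory groupCohomology
open Literature.AlgebraicGeometry.HodgeTheory
open _root_.Topology Filter

namespace Summit.HodgeConjecture.HodgeConjecture.Theorems

universe u v

variable {k S : Type u} [CommRing k] [TopologicalSpace S] {T : Type v} [TopologicalSpace T]

/-! ### The local kernel on a piece `N`, granted the surrogate at its local subgroups -/

/-- **The typed shape of the local Schnell theorem on a piece.** If the surrogate
`ker (evalCoinvOn A S') = H1resKer A S'` holds at every local subgroup
`S' = localSubgroup ι s N hs' γ` of `N ⊆ T` (for the monodromy representation `A = V_s`), then the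
tree's `localKernelOn ι V s N` — the classes restricting to zero on all of them — is the space of
classes undetected by Schnell's third map on all of them.
[cite: BrosnanFangNiePearlstein2009, §1 eq. (1)] -/
theorem localTubeSpan_localKernelOn_eq_iInf_ker_of_surrogate
    (ι : C(S, T)) (V : Literature.AlgebraicGeometry.Motives.LocalSystem k S) (s : S) (N : Set T)
    (h : ∀ (s' : S) (hs' : ι s' ∈ N) (γ : Path s' s),
      LinearMap.ker (evalCoinvOn (monodromyRepObj V s) (localSubgroup ι s N hs' γ)) =
        H1resKer (monodromyRepObj V s) (localSubgroup ι s N hs' γ)) :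
    localKernelOn ι V s N = ⨅ (s' : S) (hs' : ι s' ∈ N) (γ : Path s' s),
      LinearMap.ker (evalCoinvOn (monodromyRepObj V s) (localSubgroup ι s N hs' γ)) := by
  rw [localKernelOn]
  exact iInf_congr fun s' => iInf_congr fun hs' => iInf_congr fun γ => (h s' hs' γ).symm

/-! ### The local kernel at a point, granted the surrogate everywhere -/

/-- **The typed shape of the local Schnell theorem at a point.** If the surrogate
`ker (evalCoinvOn A S') = H1resKer A S'` holds at every local subgroup
`S' = localSubgroup ι s N hs' γ` of every piece `N ⊆ T`, then a class `ξ` lies in the local kernel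
at `t₀` (the kernel of `H¹(S, 𝕍) → (R¹ j_* 𝕍)_{t₀}` of loc. cit.) iff Schnell's third map kills it on
all local subgroups of some neighbourhood of `t₀`.
[cite: BrosnanFangNiePearlstein2009, §1 eq. (1)] -/
theorem localTubeSpan_mem_localKernel_iff_of_surrogate
    (ι : C(S, T)) (V : Literature.AlgebraicGeometry.Motives.LocalSystem k S) (s : S)
    (h : ∀ (N : Set T) (s' : S) (hs' : ι s' ∈ N) (γ : Path s' s),
      LinearMap.ker (evalCoinvOn (monodromyRepObj V s) (localSubgroup ι s N hs' γ)) =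
        H1resKer (monodromyRepObj V s) (localSubgroup ι s N hs' γ))
    (t₀ : T) (ξ : H1 (monodromyRepObj V s)) :
    ξ ∈ localKernel ι V s t₀ ↔ ∃ N ∈ 𝓝 t₀, ∀ (s' : S) (hs' : ι s' ∈ N) (γ : Path s' s),
      evalCoinvOn (monodromyRepObj V s) (localSubgroup ι s N hs' γ) ξ = 0 := by
  rw [mem_localKernel_iff]
  refine exists_congr fun N => and_congr_right fun _ => ?_
  refine forall₃_congr fun s' hs' γ => ?_
  rw [← h N s' hs' γ, LinearMap.mem_ker]

end Summit.HodgeConjecture.HodgeConjecture.Theorems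

end
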